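import Literature.Computability.AlgebraicComplexity.AlmanLi2026OneFunctionalSpeedup
import Literature.Computability.AlgebraicComplexity.AlmanLi2026IsolatedSummand
import Literature.Computability.AlgebraicComplexity.AlmanLi2026Bootstrap
import Mathlib.LinearAlgebra.Matrix.Kronecker
import HarnessLib

/-!
# The iterated free lunch (Alman–Li 2026, the engine of Thm. 6.2), over any field

Topic `Literature/Computability/AlgebraicComplexity` (family `MatrixMultiplication`). Source: J. Alman,
B. Li, *Asymptotic Rank Speedup Theorems, Revisited*, arXiv:2605.21738 (2026), §6, Theorem 6.2 and
its proof (held text `paper:arxiv-2605.21738`, p0015 L57–97): "Since the summand `⟨1,t,1⟩` … is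
produced via the one-slice speedup theorem, (prop:speedup_isolated) and (prop:speedup_full) guarantee
that this summand is full and isolated w.r.t. the degeneration. Upon taking the tensor square,
(prop:prod_isolated) and (prop:prod_full) guarantee that the summand `⟨1,t²,1⟩` … remains full and
isolated. Let this summand be projected by a linear functional `f` in the third mode. First, we zero
out the variables of this summand in all three directions, so that for the remaining degeneration
… `f` satisfies the condition of (prop:freelunch_oneslice), as `f` is isolated. The parameter `r`
corresponds to the fullness of `f` … Thus the replaced direct summand … has `t' = (r+s)² − 2(n² + 2nt)`."

This file proves that argument ONCE, generically, for the explicit free-lunch data of Thm. 5.1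
(`AlmanLi2026FreeLunchSpeedup`): from restriction data `T = (A ⊗ B ⊗ C) S`, `T' = (A' ⊗ B' ⊗ C') S`
over a field `K` with Thm. 5.1's three vanishing conditions, and ONE row `f = C'_{z₀}` of `C'` whose
contraction `M_f = (id ⊗ id ⊗ f) S` is FULL (square with a right inverse), we get over `K`
`(T ⊕ T')^{⊠2}∖(T'⊠T') ⊕ ⟨1, |ι|² − (n² + 2nn') − (m² + 2mm'), 1⟩ ⊴ S ⊠ S`
(`AlmanLi2026.iteratedFreeLunch`), where `(T ⊕ T')^{⊠2}∖(T'⊠T')` (`squareMinusCorner T T'`) is the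
Kronecker square with the corner block `T' ⊠ T'` removed ("zero out the variables of this summand"),
`n, m` are the row counts of `A, B` and `n', m'` those of `A', B'`.  Route, as printed but with the
degeneration parameter `ε` adjoined generically: over `F = K(ε)` (`RatFunc K`) the order-2 data
`Â = (A;εA'), B̂, Ĉ` of Thm. 5.1 and their Kronecker squares are honest matrices; the corner is
isolated (`prop51`, `prop52`, `AlmanLi2026IsolatedSummand`), so after deleting its rows the functional
`f ⊗ f` satisfies Prop. 5.3's condition EXACTLY; the free lunch with one functional over the field `F`
(`freeLunch_oneFunctional`) appends the slice, of size `rank_F − …` with `rank_F (M_f ⊗ M_f) = |ι|²`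
by the right inverse; finally the bootstrapping `ε := λ^N` of Cor. 5.1 (`AlmanLi2026Bootstrap`)
returns to `K`, the target being the `ε⁴`-leading term of the deleted-corner square.
No named facts; Thm. 6.2 itself (the display for `T` of border rank `r` with `S = ⟨r⟩ ⊕ ⟨1,s,1⟩`)
and its `cw_q` instance (the tree's fact `AlmanLi2026_iteratedSpeedup_cw`) are NOT derived here.

## References

* J. Alman, B. Li, *Asymptotic Rank Speedup Theorems, Revisited*, arXiv:2605.21738 (2026), §5.2.1,
  Prop. 5.3, Thm. 6.2 (held text p0013, p0015 L57–97). [AlmanLi2026]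
* P. Bürgisser, M. Clausen, M. A. Shokrollahi, *Algebraic Complexity Theory* (1997), (15.19),
  (15.25). [BurgisserClausenShokrollahi1997]
-/

noncomputable section

open scoped BigOperators Polynomial Kronecker
open Polynomial

namespace Literature.Computability.AlgebraicComplexity

universe u

variable {K : Type u}
variable {ι κ μ ι' κ' μ' α β ν : Type*}

namespace AlmanLi2026

/-! ## The explicit free-lunch matrices of Thm. 5.1, named -/

/-- Thm. 5.1's first (and second) mode matrix `Â = (A ; εA')` (rows of `A` at weight `ε⁰`, rows of
`A'` at weight `ε¹`), as in `isApproxRestriction_freeLunch`. [cite: AlmanLi2026, Thm. 5.1 (proof)] -/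
def freeLunchAB [CommSemiring K] (A : ι' → ι → K) (A' : α → ι → K) : ι' ⊕ α → ι → K[X] :=
  fun r a => Sum.elim (fun a' => Polynomial.C (A a' a) * X ^ 0)
    (fun x => Polynomial.C (A' x a) * X ^ 1) r

/-- Thm. 5.1's third mode matrix `Ĉ = (ε²C ; C')`. [cite: AlmanLi2026, Thm. 5.1 (proof)] -/
def freeLunchC [CommSemiring K] (C₀ : μ' → μ → K) (C' : ν → μ → K) : μ' ⊕ ν → μ → K[X] :=
  fun r c => Sum.elim (fun c' => Polynomial.C (C₀ c' c) * X ^ 2)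
    (fun z => Polynomial.C (C' z c) * X ^ 0) r

/-- Unfolding `freeLunchAB` on an `A`-row (weight `ε⁰`). [cite: AlmanLi2026, Thm. 5.1 (proof)] -/
@[simp] theorem freeLunchAB_inl [CommSemiring K] (A : ι' → ι → K) (A' : α → ι → K) (a' : ι')
    (a : ι) : freeLunchAB A A' (Sum.inl a') a = Polynomial.C (A a' a) * X ^ 0 := rfl

/-- Unfolding `freeLunchAB` on an `A'`-row (weight `ε¹`). [cite: AlmanLi2026, Thm. 5.1 (proof)] -/
@[simp] theorem freeLunchAB_inr [CommSemiring K] (A : ι' → ι → K) (A' : α → ι → K) (x : α)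
    (a : ι) : freeLunchAB A A' (Sum.inr x) a = Polynomial.C (A' x a) * X ^ 1 := rfl

/-- Unfolding `freeLunchC` on a `C`-row (weight `ε²`). [cite: AlmanLi2026, Thm. 5.1 (proof)] -/
@[simp] theorem freeLunchC_inl [CommSemiring K] (C₀ : μ' → μ → K) (C' : ν → μ → K) (c' : μ')
    (c : μ) : freeLunchC C₀ C' (Sum.inl c') c = Polynomial.C (C₀ c' c) * X ^ 2 := rfl

/-- Unfolding `freeLunchC` on a `C'`-row (weight `ε⁰`). [cite: AlmanLi2026, Thm. 5.1 (proof)] -/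
@[simp] theorem freeLunchC_inr [CommSemiring K] (C₀ : μ' → μ → K) (C' : ν → μ → K) (z : ν)
    (c : μ) : freeLunchC C₀ C' (Sum.inr z) c = Polynomial.C (C' z c) * X ^ 0 := rfl

/-! ## The square with the corner `T' ⊠ T'` deleted -/

/-- The rows of `(ι' ⊕ α) × (ι' ⊕ α)` outside the corner `α × α`, as the image of
`(ι' × ι') ⊕ (ι' × α) ⊕ (α × ι')` ("zero out the variables of this summand").
[cite: AlmanLi2026, Thm. 6.2 (proof)] -/
def cornerCompl (ι' α : Type*) : (ι' × ι') ⊕ ((ι' × α) ⊕ (α × ι')) → (ι' ⊕ α) × (ι' ⊕ α) :=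
  Sum.elim (fun p => (Sum.inl p.1, Sum.inl p.2))
    (Sum.elim (fun p => (Sum.inl p.1, Sum.inr p.2)) (fun p => (Sum.inr p.1, Sum.inl p.2)))

/-- No row in the image of `cornerCompl` lies in the corner `α × α` ("zero out the variables of this
summand in all three directions"). [cite: AlmanLi2026, Thm. 6.2 (proof)] -/
theorem cornerCompl_not_corner (ι' α : Type*) (x : (ι' × ι') ⊕ ((ι' × α) ⊕ (α × ι'))) :
    ¬((cornerCompl ι' α x).1.isRight = true ∧ (cornerCompl ι' α x).2.isRight = true) := by
  rcases x with p | p | p <;> simp [cornerCompl]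

/-- `(T ⊕ T')^{⊠2}` with the corner block `T' ⊠ T'` deleted in all three modes: the tensor
`T^{⊠2} ⊕ T ⊠ T' ⊕ T' ⊠ T` of Thm. 6.2's left-hand side, in the coordinates of the square.
[cite: AlmanLi2026, Thm. 6.2] -/
def squareMinusCorner [CommSemiring K] (T : ι' → κ' → μ' → K) (T' : α → β → ν → K) :
    (ι' × ι') ⊕ ((ι' × α) ⊕ (α × ι')) → (κ' × κ') ⊕ ((κ' × β) ⊕ (β × κ')) →
      (μ' × μ') ⊕ ((μ' × ν) ⊕ (ν × μ')) → K :=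
  fun x y w => kroneckerTensor (directSumTensor T T') (directSumTensor T T')
    (cornerCompl ι' α x) (cornerCompl κ' β y) (cornerCompl μ' ν w)

/-! ## The engine -/

section Engine

variable {K : Type} [Field K]
variable [Fintype ι] [Fintype κ] [Fintype μ] [Fintype ι'] [Fintype κ'] [Fintype μ'] [Fintype α]
  [Fintype β] [Fintype ν] [DecidableEq ι] [DecidableEq κ] [DecidableEq μ] [DecidableEq ι']
  [DecidableEq κ'] [DecidableEq μ'] [DecidableEq α] [DecidableEq β] [DecidableEq ν]

/-- **Alman–Li 2026, the iterated free lunch (proof of Thm. 6.2), for Thm. 5.1's data over a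
field.** Let `T = (A ⊗ B ⊗ C) S` and `T' = (A' ⊗ B' ⊗ C') S` with `(A ⊗ B ⊗ C') S = 0`,
`(A' ⊗ B ⊗ C') S = 0`, `(A ⊗ B' ⊗ C') S = 0` (so `T ⊕ T' ⊴ S`, Thm. 5.1, with `T'` isolated,
Prop. 5.1), and let the row `f = C'_{z₀}` be FULL: `M_f = (id ⊗ id ⊗ f) S` has a right inverse `N`.
Then `S ⊠ S` degenerates to the corner-deleted square `T^{⊠2} ⊕ T⊠T' ⊕ T'⊠T` plus a slice
`⟨1, |ι|² − (n² + 2nn') − (m² + 2mm'), 1⟩` (`n = |ι'|, n' = |α|, m = |κ'|, m' = |β|`; truncated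
subtraction; trivial slice factor third). [cite: AlmanLi2026, Thm. 6.2 (proof)] -/
theorem iteratedFreeLunch {S : ι → κ → μ → K} {A : ι' → ι → K} {B : κ' → κ → K}
    {C₀ : μ' → μ → K} {A' : α → ι → K} {B' : β → κ → K} {C' : ν → μ → K}
    {T : ι' → κ' → μ' → K} {T' : α → β → ν → K}
    (hT : ∀ a' b' c', T a' b' c' = ∑ a, ∑ b, ∑ c, A a' a * B b' b * C₀ c' c * S a b c)
    (hT' : ∀ x y z, T' x y z = ∑ a, ∑ b, ∑ c, A' x a * B' y b * C' z c * S a b c)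
    (hC' : ∀ a' b' z, (∑ a, ∑ b, ∑ c, A a' a * B b' b * C' z c * S a b c) = 0)
    (hA' : ∀ x b' z, (∑ a, ∑ b, ∑ c, A' x a * B b' b * C' z c * S a b c) = 0)
    (hB' : ∀ a' y z, (∑ a, ∑ b, ∑ c, A a' a * B' y b * C' z c * S a b c) = 0)
    (z₀ : ν) (N : Matrix κ ι K)
    (hMN : (Matrix.of fun a b => ∑ c, C' z₀ c * S a b c) * N = 1) :
    AlgDegeneratesTo (kroneckerTensor S S)
      (directSumTensor (squareMinusCorner T T') (rotate (oneSliceTensor K (Fin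
        (Fintype.card ι * Fintype.card ι -
          (Fintype.card ((ι' × ι') ⊕ ((ι' × α) ⊕ (α × ι'))) +
            Fintype.card ((κ' × κ') ⊕ ((κ' × β) ⊕ (β × κ'))))))))) := by
  classical
  -- the field `F = K(ε)` and `φ : K[ε] → F`
  set φ : K[X] →+* RatFunc K := algebraMap K[X] (RatFunc K) with hφdef
  -- Thm. 5.1's order-2 data and its Kronecker square (order 4)
  have hdeg1 : IsApproxRestriction 2 S (directSumTensor T T') (freeLunchAB A A')
      (freeLunchAB B B') (freeLunchC C₀ C') :=
    isApproxRestriction_freeLunch hT hT' hC' hA' hB'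
  have hdeg2 := hdeg1.kronecker hdeg1
  -- isolation of the corner (Props. 5.1, 5.2)
  have hiso1 : IsIsolatedThird S (freeLunchAB A A') (freeLunchAB B B') (freeLunchC C₀ C')
      (fun r => Sum.isRight r = true) (fun r => Sum.isRight r = true)
      (fun r => Sum.isRight r = true) :=
    prop51 C₀ A' B' hC' hA' hB'
  have hiso2 := prop52 hiso1 hiso1
  -- the corner-deleted data over `F`, the `F`-tensors `S_F = S ⊠ S` and `T¹`
  set X₁ := (ι' × ι') ⊕ ((ι' × α) ⊕ (α × ι')) with hX₁
  set X₂ := (κ' × κ') ⊕ ((κ' × β) ⊕ (β × κ')) with hX₂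
  set X₃ := (μ' × μ') ⊕ ((μ' × ν) ⊕ (ν × μ')) with hX₃
  obtain ⟨P2, hP2⟩ : ∃ P2 : (ι' ⊕ α) × (ι' ⊕ α) → (κ' ⊕ β) × (κ' ⊕ β) →
      (μ' ⊕ ν) × (μ' ⊕ ν) → K[X], P2 = fun x y w =>
        ∑ a : ι × ι, ∑ b : κ × κ, ∑ c : μ × μ,
          (freeLunchAB A A' x.1 a.1 * freeLunchAB A A' x.2 a.2) *
          (freeLunchAB B B' y.1 b.1 * freeLunchAB B B' y.2 b.2) *
          (freeLunchC C₀ C' w.1 c.1 * freeLunchC C₀ C' w.2 c.2) *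
            Polynomial.C (kroneckerTensor S S a b c) := ⟨_, rfl⟩
  obtain ⟨A1, hA1⟩ : ∃ A1 : X₁ → ι × ι → RatFunc K, A1 = fun x a =>
      φ (freeLunchAB A A' (cornerCompl ι' α x).1 a.1 *
        freeLunchAB A A' (cornerCompl ι' α x).2 a.2) := ⟨_, rfl⟩
  obtain ⟨B1, hB1⟩ : ∃ B1 : X₂ → κ × κ → RatFunc K, B1 = fun y b =>
      φ (freeLunchAB B B' (cornerCompl κ' β y).1 b.1 *
        freeLunchAB B B' (cornerCompl κ' β y).2 b.2) := ⟨_, rfl⟩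
  obtain ⟨C1, hC1⟩ : ∃ C1 : X₃ → μ × μ → RatFunc K, C1 = fun w c =>
      φ (freeLunchC C₀ C' (cornerCompl μ' ν w).1 c.1 *
        freeLunchC C₀ C' (cornerCompl μ' ν w).2 c.2) := ⟨_, rfl⟩
  obtain ⟨SF, hSF⟩ : ∃ SF : ι × ι → κ × κ → μ × μ → RatFunc K,
      SF = fun a b c => φ (Polynomial.C (kroneckerTensor S S a b c)) := ⟨_, rfl⟩
  obtain ⟨T1, hT1⟩ : ∃ T1 : X₁ → X₂ → X₃ → RatFunc K, T1 = fun x y w =>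
      ∑ a, ∑ b, ∑ c, A1 x a * B1 y b * C1 w c * SF a b c := ⟨_, rfl⟩
  have hT1φ : ∀ x y w, T1 x y w =
      φ (P2 (cornerCompl ι' α x) (cornerCompl κ' β y) (cornerCompl μ' ν w)) := by
    intro x y w
    simp only [hT1, hA1, hB1, hC1, hSF, hP2, map_sum, map_mul]
  -- the functional `f ⊗ f` (`f = C'_{z₀}`, the corner's third-mode coordinate) and Prop. 5.3's
  -- condition, exact over `F` by isolation
  obtain ⟨f₀, hf₀⟩ : ∃ f₀ : μ × μ → RatFunc K, f₀ = fun c =>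
      φ (freeLunchC C₀ C' (Sum.inr z₀) c.1 * freeLunchC C₀ C' (Sum.inr z₀) c.2) := ⟨_, rfl⟩
  have hf : ∀ x y, (∑ a, ∑ b, ∑ c, A1 x a * B1 y b * f₀ c * SF a b c) = 0 := by
    intro x y
    have h0 := hiso2 (cornerCompl ι' α x) (cornerCompl κ' β y) (Sum.inr z₀, Sum.inr z₀)
      ⟨rfl, rfl⟩ (fun h => cornerCompl_not_corner ι' α x ⟨h.1.1, h.1.2⟩)
    have h1 := congrArg φ h0
    simpa only [hA1, hB1, hf₀, hSF, map_sum, map_mul, map_zero] using h1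
  -- the free lunch with one functional over the field `F`
  have hdegF := freeLunch_oneFunctional (K := RatFunc K) (S := SF) (T := T1) (A := A1) (B := B1)
    (C₀ := C1) (fun x y w => by rw [hT1]) f₀ hf
  -- fullness: `M_{f⊗f} = (M_f ⊗ M_f)` has the right inverse `N ⊗ N` over `F`, so rank `= |ι|²`
  set ψ : K →+* RatFunc K := φ.comp Polynomial.C with hψ
  have hMF : (Matrix.of fun (a : ι × ι) (b : κ × κ) => ∑ c, f₀ c * SF a b c) =
      ((Matrix.of fun a b => ∑ c, C' z₀ c * S a b c) ⊗ₖ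
        (Matrix.of fun a b => ∑ c, C' z₀ c * S a b c)).map ψ := by
    ext a b
    simp only [Matrix.of_apply, Matrix.map_apply, Matrix.kroneckerMap_apply, hf₀, hSF, hψ,
      RingHom.comp_apply, freeLunchC_inr, pow_zero, mul_one, Fintype.sum_prod_type,
      kroneckerTensor_apply, map_sum, map_mul, Finset.sum_mul_sum]
    refine Finset.sum_congr rfl fun c _ => Finset.sum_congr rfl fun c' _ => ?_
    ring
  have hrank : Fintype.card ι * Fintype.card ι ≤
      (Matrix.of fun (a : ι × ι) (b : κ × κ) => ∑ c, f₀ c * SF a b c).rank := by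
    have hinv : (Matrix.of fun (a : ι × ι) (b : κ × κ) => ∑ c, f₀ c * SF a b c) *
        (N ⊗ₖ N).map ψ = 1 := by
      rw [hMF, ← Matrix.map_mul, ← Matrix.mul_kronecker_mul, hMN, Matrix.one_kronecker_one,
        Matrix.map_one ψ (map_zero ψ) (map_one ψ)]
    have h1 := Matrix.rank_mul_le_left
      (Matrix.of fun (a : ι × ι) (b : κ × κ) => ∑ c, f₀ c * SF a b c) ((N ⊗ₖ N).map ψ)
    rw [hinv, Matrix.rank_one, Fintype.card_prod] at h1
    exact h1
  have hdegF' : AlgDegeneratesTo SF (directSumTensor T1 (rotate (oneSliceTensor (RatFunc K)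
      (Fin (Fintype.card ι * Fintype.card ι - (Fintype.card X₁ + Fintype.card X₂)))))) :=
    hdegF.trans_restrictsTo ((TensorRestrictsTo.refl _).directSum
      (tensorRestrictsTo_rotate_oneSliceTensor_of_le (by omega)))
  -- equalise the `ε`-order: scale the slice by `ε⁴` and read the target as `φ ∘ P`
  set t₀ := Fintype.card ι * Fintype.card ι - (Fintype.card X₁ + Fintype.card X₂) with ht₀
  obtain ⟨P, hPdef⟩ : ∃ P : X₁ ⊕ Fin t₀ → X₂ ⊕ Fin t₀ → X₃ ⊕ Unit → K[X],
      P = directSumTensor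
        (fun x y w => P2 (cornerCompl ι' α x) (cornerCompl κ' β y) (cornerCompl μ' ν w))
        (fun x y z => X ^ 4 * Polynomial.C (rotate (oneSliceTensor K (Fin t₀)) x y z)) :=
    ⟨_, rfl⟩
  have hscale : TensorRestrictsTo
      (directSumTensor T1 (rotate (oneSliceTensor (RatFunc K) (Fin t₀))))
      (fun a b c => φ (P a b c)) := by
    refine ⟨fun a a' => if a' = a then 1 else 0, fun b b' => if b' = b then 1 else 0,
      fun c c' => if c' = c then Sum.elim (fun _ => (1 : RatFunc K)) (fun _ => φ X ^ 4) c else 0,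
      fun a b c => ?_⟩
    rw [Finset.sum_eq_single a (fun x _ hx => by simp [hx]) (by simp),
      Finset.sum_eq_single b (fun x _ hx => by simp [hx]) (by simp),
      Finset.sum_eq_single c (fun x _ hx => by simp [hx]) (by simp)]
    simp only [if_true, one_mul]
    rcases a with a | a <;> rcases b with b | b <;> rcases c with c | c <;>
      simp [hPdef, directSumTensor, hT1φ, rotate_apply, oneSliceTensor_apply,
        apply_ite Polynomial.C, apply_ite φ]
  have hdegF'' : AlgDegeneratesTo (fun a b c => φ (Polynomial.C (kroneckerTensor S S a b c)))
      (fun a b c => φ (P a b c)) := by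
    rw [← hSF]
    exact hdegF'.trans_restrictsTo hscale
  -- the `ε`-adic lowest term of `P` is the corner-deleted square ⊕ the slice, at order 4
  have hPcoeff : ∀ a b c, ∀ j ≤ 4, (P a b c).coeff j = if j = 4 then
      directSumTensor (squareMinusCorner T T') (rotate (oneSliceTensor K (Fin t₀))) a b c
      else 0 := by
    intro a b c j hj
    rcases a with a | a <;> rcases b with b | b <;> rcases c with c | c
    · rw [hPdef, directSumTensor_inl, directSumTensor_inl, hP2]
      exact hdeg2 (cornerCompl ι' α a) (cornerCompl κ' β b) (cornerCompl μ' ν c) j hj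
    · simp [hPdef, directSumTensor]
    · simp [hPdef, directSumTensor]
    · simp [hPdef, directSumTensor]
    · simp [hPdef, directSumTensor]
    · simp [hPdef, directSumTensor]
    · simp [hPdef, directSumTensor]
    · rw [hPdef, directSumTensor_inr, directSumTensor_inr, Polynomial.coeff_X_pow_mul',
        Polynomial.coeff_C]
      by_cases hj4 : j = 4
      · subst hj4
        simp
      · rw [if_neg hj4]
        split_ifs with h1 h2
        · omega
        · rfl
        · rfl
  -- bootstrap `K(ε) → K`
  exact algDegeneratesTo_of_isFractionRing (K := K) (L := RatFunc K) hPcoeff hdegF''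

end Engine

/-! ## Thm. 6.2 for rank decompositions (the setting of Thm. 6.1, `λ`-free) -/

section Thm62

variable {K : Type} [Field K]

/-- A triple sum against the unit tensor collapses to the diagonal. [folklore] -/
private theorem sum_unitTensor_eq'' {r : ℕ} (F G H : Fin r → K) :
    (∑ a, ∑ b, ∑ c, F a * G b * H c * unitTensor K r a b c) = ∑ i, F i * G i * H i := by
  refine Finset.sum_congr rfl fun i _ => ?_
  rw [Finset.sum_eq_single i (fun j _ hj => by simp [Ne.symm hj]) (by simp),
    Finset.sum_eq_single i (fun k _ hk => by simp [Ne.symm hk]) (by simp)]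
  simp

/-- Absorbing a restriction of the first two modes (third mode trivial) into the restriction
data: `(G ⊗ H ⊗ j)[(A'' ⊗ B'' ⊗ f) S] = ((jGA'') ⊗ (HB'') ⊗ f) S`. [folklore] -/
private theorem absorb_sum {X Y γ δ ι₀ κ₀ μ₀ : Type*} [Fintype X] [Fintype Y] [Fintype γ]
    [Fintype δ] [Fintype ι₀] [Fintype κ₀] [Fintype μ₀]
    (G : X → γ → K) (H : Y → δ → K) (j : K) (A₂ : γ → ι₀ → K) (B₂ : δ → κ₀ → K) (f : μ₀ → K)
    (S : ι₀ → κ₀ → μ₀ → K) (x : X) (y : Y) :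
    (∑ x₂, ∑ y₂, G x x₂ * H y y₂ * j * ∑ a, ∑ b, ∑ c, A₂ x₂ a * B₂ y₂ b * f c * S a b c) =
      ∑ a, ∑ b, ∑ c, (j * ∑ x₂, G x x₂ * A₂ x₂ a) * (∑ y₂, H y y₂ * B₂ y₂ b) * f c * S a b c := by
  simp only [Finset.mul_sum, Finset.sum_mul]
  conv_lhs => arg 2; ext x₂; rw [Finset.sum_comm]
  conv_lhs => rw [Finset.sum_comm]
  conv_lhs => arg 2; ext a; arg 2; ext x₂; rw [Finset.sum_comm]
  conv_lhs => arg 2; ext a; rw [Finset.sum_comm]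
  conv_lhs => arg 2; ext a; arg 2; ext b; arg 2; ext x₂; rw [Finset.sum_comm]
  conv_lhs => arg 2; ext a; arg 2; ext b; rw [Finset.sum_comm]
  conv_lhs => arg 2; ext a; arg 2; ext b; arg 2; ext c; rw [Finset.sum_comm]
  refine Finset.sum_congr rfl fun a _ => Finset.sum_congr rfl fun b _ =>
    Finset.sum_congr rfl fun c _ => Finset.sum_congr rfl fun x₂ _ =>
    Finset.sum_congr rfl fun y₂ _ => ?_
  ring

/-- Linear combinations of annihilating rows annihilate (first mode). [folklore] -/
private theorem lincomb_annihilatesA {X γ ι₀ κ₀ μ₀ : Type*} [Fintype X] [Fintype γ] [Fintype ι₀]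
    [Fintype κ₀] [Fintype μ₀] (G : X → γ → K) (j : K) (A₂ : γ → ι₀ → K) (v : κ₀ → K)
    (f : μ₀ → K) (S : ι₀ → κ₀ → μ₀ → K) (x : X)
    (h : ∀ x₂, (∑ a, ∑ b, ∑ c, A₂ x₂ a * v b * f c * S a b c) = 0) :
    (∑ a, ∑ b, ∑ c, (j * ∑ x₂, G x x₂ * A₂ x₂ a) * v b * f c * S a b c) = 0 := by
  calc (∑ a, ∑ b, ∑ c, (j * ∑ x₂, G x x₂ * A₂ x₂ a) * v b * f c * S a b c)
      = ∑ x₂, j * G x x₂ * (∑ a, ∑ b, ∑ c, A₂ x₂ a * v b * f c * S a b c) := by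
        simp only [Finset.mul_sum, Finset.sum_mul]
        conv_lhs => arg 2; ext a; arg 2; ext b; rw [Finset.sum_comm]
        conv_lhs => arg 2; ext a; rw [Finset.sum_comm]
        conv_lhs => rw [Finset.sum_comm]
        refine Finset.sum_congr rfl fun x₂ _ => Finset.sum_congr rfl fun a _ =>
          Finset.sum_congr rfl fun b _ => Finset.sum_congr rfl fun c _ => ?_
        ring
    _ = 0 := by simp [h]

/-- Linear combinations of annihilating rows annihilate (second mode). [folklore] -/
private theorem lincomb_annihilatesB {Y δ ι₀ κ₀ μ₀ : Type*} [Fintype Y] [Fintype δ] [Fintype ι₀]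
    [Fintype κ₀] [Fintype μ₀] (H : Y → δ → K) (u : ι₀ → K) (B₂ : δ → κ₀ → K) (f : μ₀ → K)
    (S : ι₀ → κ₀ → μ₀ → K) (y : Y)
    (h : ∀ y₂, (∑ a, ∑ b, ∑ c, u a * B₂ y₂ b * f c * S a b c) = 0) :
    (∑ a, ∑ b, ∑ c, u a * (∑ y₂, H y y₂ * B₂ y₂ b) * f c * S a b c) = 0 := by
  calc (∑ a, ∑ b, ∑ c, u a * (∑ y₂, H y y₂ * B₂ y₂ b) * f c * S a b c)
      = ∑ y₂, H y y₂ * (∑ a, ∑ b, ∑ c, u a * B₂ y₂ b * f c * S a b c) := by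
        simp only [Finset.mul_sum, Finset.sum_mul]
        conv_lhs => arg 2; ext a; arg 2; ext b; rw [Finset.sum_comm]
        conv_lhs => arg 2; ext a; rw [Finset.sum_comm]
        conv_lhs => rw [Finset.sum_comm]
        refine Finset.sum_congr rfl fun y₂ _ => Finset.sum_congr rfl fun a _ =>
          Finset.sum_congr rfl fun b _ => Finset.sum_congr rfl fun c _ => ?_
        ring
    _ = 0 := by simp [h]

variable [Fintype ι] [Fintype κ] [Fintype μ] [Fintype ι'] [Fintype κ'] [Fintype μ']
  [DecidableEq ι] [DecidableEq κ] [DecidableEq μ] [DecidableEq ι'] [DecidableEq κ'] [DecidableEq μ']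

omit [Fintype μ'] [DecidableEq ι] [DecidableEq κ] [DecidableEq μ] [DecidableEq μ'] in
/-- **The data behind the one-functional speedup** (Alman–Li 2026, proof of Thm. 6.1: Prop. 5.4's
extended restriction data on `S ⊕ ⟨1,s,1⟩`, Thm. 5.1's annihilator bases, Prop. 5.3's rank count),
exposed for iteration: matrices `P, Q` with `T = [(A P) ⊗ (B Q) ⊗ (C 0)](S ⊕ ⟨1,s,1⟩)`, the
functional `f' = (f, −1)` annihilated by that data, annihilator bases `A'', B''`, and the tensor
`T'' = (A'' ⊗ B'' ⊗ f')(S ⊕ ⟨1,s,1⟩)` restricting to the slice `⟨1, q + s − (n+m), 1⟩`.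
[cite: AlmanLi2026, Thm. 6.1 (proof) with Props. 5.3, 5.4] -/
theorem oneFunctional_data {S : ι → κ → μ → K} {T : ι' → κ' → μ' → K} {A : ι' → ι → K}
    {B : κ' → κ → K} {C₀ : μ' → μ → K}
    (hT : ∀ a' b' c', T a' b' c' = ∑ a, ∑ b, ∑ c, A a' a * B b' b * C₀ c' c * S a b c)
    (f : μ → K) {s : ℕ}
    (hs : (Matrix.of fun a' b' => ∑ a, ∑ b, ∑ c, A a' a * B b' b * f c * S a b c).rank ≤ s) :
    ∃ (P : ι' → Fin s → K) (Q : κ' → Fin s → K) (dA dB : ℕ) (A'' : Fin dA → ι ⊕ Fin s → K)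
      (B'' : Fin dB → κ ⊕ Fin s → K),
      (∀ a' b' c', T a' b' c' = ∑ x, ∑ y, ∑ z, Sum.elim (A a') (P a') x * Sum.elim (B b') (Q b') y *
        Sum.elim (C₀ c') (fun _ => (0 : K)) z *
          directSumTensor S (rotate (oneSliceTensor K (Fin s))) x y z) ∧
      (∀ a' b' (z : Unit), (∑ x, ∑ y, ∑ w, Sum.elim (A a') (P a') x * Sum.elim (B b') (Q b') y *
        (fun _ : Unit => Sum.elim f (fun _ : Unit => (-1 : K))) z w *
          directSumTensor S (rotate (oneSliceTensor K (Fin s))) x y w) = 0) ∧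
      (∀ i b' (z : Unit), (∑ x, ∑ y, ∑ w, A'' i x * Sum.elim (B b') (Q b') y *
        (fun _ : Unit => Sum.elim f (fun _ : Unit => (-1 : K))) z w *
          directSumTensor S (rotate (oneSliceTensor K (Fin s))) x y w) = 0) ∧
      (∀ a' i (z : Unit), (∑ x, ∑ y, ∑ w, Sum.elim (A a') (P a') x * B'' i y *
        (fun _ : Unit => Sum.elim f (fun _ : Unit => (-1 : K))) z w *
          directSumTensor S (rotate (oneSliceTensor K (Fin s))) x y w) = 0) ∧
      TensorRestrictsTo
        (fun (i : Fin dA) (i' : Fin dB) (_ : Unit) => ∑ x, ∑ y, ∑ w, A'' i x * B'' i' y *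
          Sum.elim f (fun _ : Unit => (-1 : K)) w *
            directSumTensor S (rotate (oneSliceTensor K (Fin s))) x y w)
        (rotate (oneSliceTensor K (Fin
          ((Matrix.of fun a b => ∑ c, f c * S a b c).rank + s -
            (Fintype.card ι' + Fintype.card κ'))))) := by
  classical
  -- Prop. 5.4: factor `M = (A ⊗ B ⊗ f) S = P Qᵀ` through `K^s`
  obtain ⟨P, Q, hPQ⟩ := Literature.LinearAlgebra.Matrix.exists_eq_mul_transpose_of_rank_le _ hs
  have hM : ∀ a' b', (∑ a, ∑ b, ∑ c, A a' a * B b' b * f c * S a b c) = ∑ i, P a' i * Q b' i := by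
    intro a' b'
    have h := congrFun (congrFun hPQ a') b'
    simpa only [Matrix.of_apply, Matrix.mul_apply, Matrix.transpose_apply] using h
  set S' : ι ⊕ Fin s → κ ⊕ Fin s → μ ⊕ Unit → K :=
    directSumTensor S (rotate (oneSliceTensor K (Fin s))) with hS'
  set Ae : ι' → ι ⊕ Fin s → K := fun a' => Sum.elim (A a') (P a') with hAe
  set Be : κ' → κ ⊕ Fin s → K := fun b' => Sum.elim (B b') (Q b') with hBe
  set f' : μ ⊕ Unit → K := Sum.elim f (fun _ : Unit => (-1 : K)) with hf'
  set VA := LinearMap.ker (Matrix.of fun (b' : κ') (x : ι ⊕ Fin s) =>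
    ∑ y, ∑ w, Be b' y * f' w * S' x y w).mulVecLin with hVA
  set VB := LinearMap.ker (Matrix.of fun (a' : ι') (y : κ ⊕ Fin s) =>
    ∑ x, ∑ w, Ae a' x * f' w * S' x y w).mulVecLin with hVB
  set bA := Module.finBasis K VA
  set bB := Module.finBasis K VB
  set A'' : Fin (Module.finrank K VA) → ι ⊕ Fin s → K := fun x => ((bA x : VA) : ι ⊕ Fin s → K)
    with hA''
  set B'' : Fin (Module.finrank K VB) → κ ⊕ Fin s → K := fun y => ((bB y : VB) : κ ⊕ Fin s → K)
    with hB''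
  set T'' : Fin (Module.finrank K VA) → Fin (Module.finrank K VB) → Unit → K :=
    fun x y _ => ∑ a, ∑ b, ∑ c, A'' x a * B'' y b * f' c * S' a b c with hT''
  have hA''mem : ∀ x b' (z : Unit),
      (∑ a, ∑ b, ∑ c, A'' x a * Be b' b * (fun _ : Unit => f') z c * S' a b c) = 0 := by
    intro x b' z
    exact (mem_ker_annihilatorA_iff S' Be f' (A'' x)).1 (bA x).2 b'
  have hB''mem : ∀ a' y (z : Unit),
      (∑ a, ∑ b, ∑ c, Ae a' a * B'' y b * (fun _ : Unit => f') z c * S' a b c) = 0 := by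
    intro a' y z
    exact (mem_ker_annihilatorB_iff S' Ae f' (B'' y)).1 (bB y).2 a'
  have hA''span : ∀ u : ι ⊕ Fin s → K,
      (∀ b', (∑ a, ∑ b, ∑ c, u a * Be b' b * f' c * S' a b c) = 0) →
        u ∈ Submodule.span K (Set.range A'') := by
    intro u hu
    have hmem : u ∈ VA := (mem_ker_annihilatorA_iff S' Be f' u).2 hu
    have hspan : Submodule.span K (Set.range A'') = VA := by
      have h := congrArg (Submodule.map VA.subtype) bA.span_eq
      rwa [Submodule.map_span, ← Set.range_comp, Submodule.map_subtype_top] at h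
    rw [hspan]
    exact hmem
  have hB''span : ∀ v : κ ⊕ Fin s → K,
      (∀ a', (∑ a, ∑ b, ∑ c, Ae a' a * v b * f' c * S' a b c) = 0) →
        v ∈ Submodule.span K (Set.range B'') := by
    intro v hv
    have hmem : v ∈ VB := (mem_ker_annihilatorB_iff S' Ae f' v).2 hv
    have hspan : Submodule.span K (Set.range B'') = VB := by
      have h := congrArg (Submodule.map VB.subtype) bB.span_eq
      rwa [Submodule.map_span, ← Set.range_comp, Submodule.map_subtype_top] at h
    rw [hspan]
    exact hmem
  -- Prop. 5.3: the matrix of `T''` has rank `t ≥ (q + s) − n − m`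
  have hrank := prop53_rank (T' := T'') (fun x y z => by rw [hT'']) hA''span hB''span
  have hq : (Matrix.of fun (x : ι ⊕ Fin s) (y : κ ⊕ Fin s) => ∑ w, f' w * S' x y w).rank =
      (Matrix.of fun a b => ∑ c, f c * S a b c).rank + s := by
    rw [hf', hS', contraction_eq_fromBlocks, rank_fromBlocks_neg_one, Fintype.card_fin]
  rw [hq] at hrank
  have hslice := (restrictsTo_oneSlice_of_flattening_rank_eq T'' rfl).trans
    (tensorRestrictsTo_rotate_oneSliceTensor_of_le (K := K)
      (t := (Matrix.of fun x y => T'' x y ()).rank)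
      (t₀ := (Matrix.of fun a b => ∑ c, f c * S a b c).rank + s -
        (Fintype.card ι' + Fintype.card κ')) (by omega))
  refine ⟨P, Q, _, _, A'', B'', fun a' b' c' => prop54_restriction P Q hT a' b' c',
    fun a' b' z => prop54_annihilates hM a' b' z, hA''mem, hB''mem, ?_⟩
  simpa only [hT''] using hslice

/-- The right inverse of `(id ⊗ id ⊗ f')(⟨r⟩ ⊕ ⟨1,s,1⟩) = diag(c') ⊕ (−1_s)` for nonzero scalars
`c'` ("full": fullness index `r + s`). [cite: AlmanLi2026, Thm. 6.2 (proof: "since `f` is full")] -/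
private theorem contraction_unit_slice_mul_inv {r s : ℕ} {c' : Fin r → K} (hc' : ∀ i, c' i ≠ 0) :
    (Matrix.of fun (a : Fin r ⊕ Fin s) (b : Fin r ⊕ Fin s) =>
        ∑ c, Sum.elim c' (fun _ : Unit => (-1 : K)) c *
          directSumTensor (unitTensor K r) (rotate (oneSliceTensor K (Fin s))) a b c) *
      (Matrix.of fun (a : Fin r ⊕ Fin s) (b : Fin r ⊕ Fin s) =>
        Sum.elim (fun i => Sum.elim (fun j => if i = j then (c' i)⁻¹ else 0) (fun _ => 0) b)
          (fun x => Sum.elim (fun _ => 0) (fun y => if x = y then (-1 : K) else 0) b) a) = 1 := by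
  ext a b
  rw [Matrix.mul_apply]
  conv_lhs => arg 2; ext j; rw [Matrix.of_apply, prop54_contraction, Matrix.of_apply]
  rcases a with i | x <;> rcases b with j | y
  · simp only [Fintype.sum_sum_type, Sum.elim_inl, Sum.elim_inr, mul_zero,
      Finset.sum_const_zero, add_zero, Matrix.one_apply, Sum.inl.injEq]
    have hdiag : ∀ k : Fin r, (∑ c, c' c * unitTensor K r i k c) = if i = k then c' i else 0 := by
      intro k
      by_cases hik : i = k
      · subst hik
        rw [if_pos rfl, Finset.sum_eq_single i (fun c _ hc => by simp [Ne.symm hc]) (by simp)]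
        simp
      · rw [if_neg hik]
        exact Finset.sum_eq_zero fun c _ => by simp [unitTensor_apply, hik]
    simp only [hdiag, ite_mul, zero_mul, Finset.sum_ite_eq, Finset.mem_univ, if_true]
    by_cases hij : i = j
    · subst hij; simp [hc' i]
    · simp [hij]
  · simp [Fintype.sum_sum_type]
  · simp [Fintype.sum_sum_type]
  · simp only [Fintype.sum_sum_type, Sum.elim_inl, Sum.elim_inr, mul_zero,
      Finset.sum_const_zero, zero_add, Matrix.one_apply, Sum.inr.injEq]
    simp only [ite_mul, neg_mul, one_mul, zero_mul, Finset.sum_ite_eq, Finset.mem_univ, if_true]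
    by_cases hxy : x = y
    · subst hxy; simp
    · simp [hxy]

/-- **Alman–Li 2026, Thm. 6.2, `λ`-free case (rank decompositions)**, in the engine's
coordinates. In the setting of Thm. 6.1 (`T = ∑_{i<r} aᵢ ⊗ bᵢ ⊗ cᵢ`, nonzero scalars `c'ᵢ` with
`rank ∑ c'ᵢ aᵢbᵢᵀ ≤ s`, `n = |ι'|`, `m = |κ'|`, any `t ≤ r + s − (n + m)`):
`(T ⊕ ⟨1,t,1⟩)^{⊠2}∖(⟨1,t,1⟩^{⊠2}) ⊕ ⟨1, (r+s)² − (n² + 2nt) − (m² + 2mt), 1⟩ ⊴ (⟨r⟩ ⊕ ⟨1,s,1⟩)^{⊠2}`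
— the printed `T^{⊗2} ⊕ 2⊙T⊗⟨1,t,1⟩ ⊕ ⟨1, t² + 2n², 1⟩ ⊴ ⟨r²⟩ ⊕ 2r⊙⟨1,s,1⟩ ⊕ ⟨1,s²,1⟩` for
`n = m` up to the evident relabellings (the corner-deleted square `squareMinusCorner`, the
Kronecker square of `⟨r⟩ ⊕ ⟨1,s,1⟩`), which are not performed here.
[cite: AlmanLi2026, Thm. 6.2] -/
theorem thm62_rankDecomposition {r : ℕ} {T : ι' → κ' → μ' → K} {A : ι' → Fin r → K}
    {B : κ' → Fin r → K} {C₀ : μ' → Fin r → K}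
    (hT : ∀ a' b' c', T a' b' c' = ∑ i, A a' i * B b' i * C₀ c' i)
    {c' : Fin r → K} (hc' : ∀ i, c' i ≠ 0) {s : ℕ}
    (hM : (Matrix.of fun a' b' => ∑ i, A a' i * B b' i * c' i).rank ≤ s) {t : ℕ}
    (ht : t ≤ r + s - (Fintype.card ι' + Fintype.card κ')) :
    AlgDegeneratesTo
      (kroneckerTensor (directSumTensor (unitTensor K r) (rotate (oneSliceTensor K (Fin s))))
        (directSumTensor (unitTensor K r) (rotate (oneSliceTensor K (Fin s)))))
      (directSumTensor
        (squareMinusCorner T (rotate (oneSliceTensor K (Fin t))))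
        (rotate (oneSliceTensor K (Fin ((r + s) * (r + s) -
          ((Fintype.card ι' * Fintype.card ι' + 2 * (Fintype.card ι' * t)) +
            (Fintype.card κ' * Fintype.card κ' + 2 * (Fintype.card κ' * t)))))))) := by
  classical
  -- `T ≤ ⟨r⟩` and `(A ⊗ B ⊗ c')⟨r⟩ = ∑ c'ᵢ aᵢ bᵢᵀ` in triple-sum form
  have hT' : ∀ a' b' c, T a' b' c =
      ∑ a, ∑ b, ∑ cc, A a' a * B b' b * C₀ c cc * unitTensor K r a b cc := fun a' b' c => by
    rw [sum_unitTensor_eq'', hT]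
  have hs : (Matrix.of fun a' b' => ∑ a, ∑ b, ∑ cc,
      A a' a * B b' b * c' cc * unitTensor K r a b cc).rank ≤ s := by
    have e : (Matrix.of fun a' b' => ∑ a, ∑ b, ∑ cc,
        A a' a * B b' b * c' cc * unitTensor K r a b cc)
        = Matrix.of fun a' b' => ∑ i, A a' i * B b' i * c' i := by
      ext a' b'
      rw [Matrix.of_apply, Matrix.of_apply, sum_unitTensor_eq'']
    rw [e]
    exact hM
  obtain ⟨P, Q, dA, dB, A'', B'', hTe, hfe, hA''mem, hB''mem, hslice⟩ :=
    oneFunctional_data hT' c' hs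
  -- the slice size `t`, using `rank (id ⊗ id ⊗ c')⟨r⟩ = r`
  have hdiag : (Matrix.of fun a b : Fin r => ∑ c, c' c * unitTensor K r a b c) =
      Matrix.diagonal c' := by
    ext a b
    rw [Matrix.of_apply, Matrix.diagonal_apply]
    by_cases hab : a = b
    · subst hab
      rw [if_pos rfl, Finset.sum_eq_single a (fun c _ hc => by simp [Ne.symm hc]) (by simp)]
      simp
    · rw [if_neg hab]
      exact Finset.sum_eq_zero fun c _ => by simp [unitTensor_apply, hab]
  have hrk : r ≤ (Matrix.of fun a b : Fin r => ∑ c, c' c * unitTensor K r a b c).rank := by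
    have hinv : (Matrix.of fun a b : Fin r => ∑ c, c' c * unitTensor K r a b c) *
        Matrix.diagonal (fun i => (c' i)⁻¹) = 1 := by
      rw [hdiag, Matrix.diagonal_mul_diagonal, ← Matrix.diagonal_one]
      congr 1
      funext i
      exact mul_inv_cancel₀ (hc' i)
    have h1 := Matrix.rank_mul_le_left
      (Matrix.of fun a b : Fin r => ∑ c, c' c * unitTensor K r a b c)
      (Matrix.diagonal fun i => (c' i)⁻¹)
    rw [hinv, Matrix.rank_one, Fintype.card_fin] at h1
    exact h1
  -- absorb the restriction `T'' ≥ ⟨1,t,1⟩` (shrunk to size `t`) into the data (`G A''`, `H B''`)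
  obtain ⟨G, H, J, hGHJ⟩ := hslice.trans
    (tensorRestrictsTo_rotate_oneSliceTensor_of_le (K := K) (t₀ := t) (by omega))
  set S' := directSumTensor (unitTensor K r) (rotate (oneSliceTensor K (Fin s))) with hS'
  set f' : Fin r ⊕ Unit → K := Sum.elim c' (fun _ : Unit => (-1 : K)) with hf'
  obtain ⟨A₃, hA₃⟩ : ∃ A₃ : Fin t → Fin r ⊕ Fin s → K,
      A₃ = fun x a => J () () * ∑ x₂, G x x₂ * A'' x₂ a := ⟨_, rfl⟩
  obtain ⟨B₃, hB₃⟩ : ∃ B₃ : Fin t → Fin r ⊕ Fin s → K,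
      B₃ = fun y b => ∑ y₂, H y y₂ * B'' y₂ b := ⟨_, rfl⟩
  have hslice' : ∀ x y z, rotate (oneSliceTensor K (Fin t)) x y z =
      ∑ a, ∑ b, ∑ c, A₃ x a * B₃ y b * (fun _ : Unit => f') z c * S' a b c := by
    intro x y z
    rw [hGHJ x y z]
    simp only [Fintype.sum_unique, hA₃, hB₃]
    rcases z with ⟨⟩
    exact absorb_sum G H (J () ()) A'' B'' f' S' x y
  have hA₃mem : ∀ x b' (z : Unit), (∑ a, ∑ b, ∑ c, A₃ x a * Sum.elim (B b') (Q b') b *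
      (fun _ : Unit => f') z c * S' a b c) = 0 := by
    intro x b' z
    rw [hA₃]
    exact lincomb_annihilatesA G (J () ()) A'' (Sum.elim (B b') (Q b')) f' S' x
      (fun x₂ => hA''mem x₂ b' z)
  have hB₃mem : ∀ a' y (z : Unit), (∑ a, ∑ b, ∑ c, Sum.elim (A a') (P a') a * B₃ y b *
      (fun _ : Unit => f') z c * S' a b c) = 0 := by
    intro a' y z
    rw [hB₃]
    exact lincomb_annihilatesB H (Sum.elim (A a') (P a')) B'' f' S' y
      (fun y₂ => hB''mem a' y₂ z)
  -- the engine, with the full functional `f'` (right inverse `diag(c'⁻¹) ⊕ (−1)`)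
  have hE := iteratedFreeLunch (S := S') (T := T) (T' := rotate (oneSliceTensor K (Fin t)))
    (A := fun a' => Sum.elim (A a') (P a')) (B := fun b' => Sum.elim (B b') (Q b'))
    (C₀ := fun c => Sum.elim (C₀ c) (fun _ => (0 : K))) (A' := A₃) (B' := B₃)
    (C' := fun _ : Unit => f') hTe hslice' hfe hA₃mem hB₃mem ()
    _ (contraction_unit_slice_mul_inv (s := s) hc')
  -- cardinalities
  refine hE.trans_restrictsTo ((TensorRestrictsTo.refl _).directSum
    (tensorRestrictsTo_rotate_oneSliceTensor_of_le (le_of_eq ?_)))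
  simp only [Fintype.card_sum, Fintype.card_prod, Fintype.card_fin]
  ring_nf

end Thm62

end AlmanLi2026

end Literature.Computability.AlgebraicComplexity
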